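import Mathlib
import HarnessLib
import Summits.Ventures.LatticeQCDFlow.Scoring.RatioEstimatorError
import Summits.Ventures.LatticeQCDFlow.Scoring.ChainHoeffding

/-!
# Gaussian confidence for the self-normalised (reweighting) estimator along a Doeblin chain, from
# ANY start — and for the correlated-restart reweighting of row 8's non-equilibrium protocol

HONEST FRAMING: exact (Metropolis-corrected) sampling algorithms for lattice gauge theory;
figures of merit are autocorrelation/cost numbers at stated couplings and volumes; no
continuum-physics claim.

Venture `LatticeQCDFlow` (cell pub-lqcd), topic `Scoring`; FANOUT row 8 (`s0-cpn-nemc`, GEN-13).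
NEW WORK of the cell, not a published result; no definition is introduced.  The second-moment
bound for the ratio `A_N/B_N` of two time averages (`Scoring/RatioEstimatorError.lean`) is
complemented by an exponential TAIL bound: the ratio perturbation inequality
`|A/B − a/b| ≤ (|A − a| + |a/b| |B − b|)/β` splits a ratio deviation `≥ s` into a deviation
`≥ βs/2` of the numerator average or of the rescaled denominator average `(a/b) B_N` (whose mean is
`a`), and each is controlled by Hoeffding's inequality for the chain
(`Scoring/ChainHoeffding.lean`: `chain_abs_tail_le_exp_of_doeblin`, any initial law).  Instantiated
on the restart chain of `Scoring/RestartChainAutocorrelation.lean` (`invariant_restart`,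
`restart_doeblin`).  Nothing is cited as a fact.

## Content (`κ` Markov, `π` invariant, `κ(x, ·) ≥ ε π`, `ε > 0`; `μ₀` ANY probability law;
## `|f| ≤ C_f` with `a = πf`; `β ≤ g ≤ C_g`, `β > 0`, `b = πg`; `A_N, B_N` the time averages)

* `abs_div_sub_div_le` — `0 < β ≤ B`, `b ≠ 0` ⇒ `|A/B − a/b| ≤ (|A − a| + |a/b| |B − b|)/β`;
* `ratio_event_subset` — `{s ≤ |A_N/B_N − a/b|} ⊆ {βs/2 ≤ |A_N − a|} ∪ {βs/2 ≤ |(a/b)B_N − a|}`;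
* **`chain_ratio_tail_le_of_doeblin`** — with `C₁ = C_f + |a|`, `C₂ = |a/b| C_g + |a|` and
  `N β s/2 ≥ 4 max-free: 4C₁/ε ≤ Nβs/2`, `4C₂/ε ≤ Nβs/2`:
  `P_{μ₀}(|A_N/B_N − a/b| ≥ s) ≤ 2 exp(−(Nβs/2 − 4C₁/ε)²/(8NC₁²/ε²)) + 2 exp(−(Nβs/2 − 4C₂/ε)²/(8NC₂²/ε²))`;
* **`restart_ratio_tail_le_of_doeblin`** — the same along the restart chain `K(x, ω) = κ₀ x ⊗ₘ κF`
  with the PRIOR chain's Doeblin constant, for record observables `G₁` (bounded) and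
  `G₂ ∈ [β, C₂]` — the reweighting estimator `Σ G₁ / Σ G₂` of the non-equilibrium protocol.

Reading (value-free): the reweighting estimator of the correlated-restart protocol carries a
Gaussian confidence statement from any start, with the prior sweep's minorisation constant and the
work window as the only inputs.  NOT CLAIMED: any `ε`, `β`, work window for a concrete protocol;
sharpness (the split at `βs/2` and the Hoeffding constants are crude); unbounded weights.
-/

noncomputable section

namespace Summit.Ventures.LatticeQCDFlow.Scoring

open MeasureTheory ProbabilityTheory Filter Finset Preorder
open scoped ENNReal

/-! ### The ratio perturbation inequality and the event split -/

section Algebra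

/-- `0 < β ≤ B`, `b ≠ 0` ⇒ `|A/B − a/b| ≤ (|A − a| + |a/b| · |B − b|)/β`. -/
theorem abs_div_sub_div_le {A B a b β : ℝ} (hβ : 0 < β) (hB : β ≤ B) (hb : b ≠ 0) :
    |A / B - a / b| ≤ (|A - a| + |a / b| * |B - b|) / β := by
  have hB0 : 0 < B := hβ.trans_le hB
  rw [div_sub_div_eq_of_ne hB0.ne' hb, abs_div, abs_of_pos hB0]
  have hnum : |(A - a) + a / b * (b - B)| ≤ |A - a| + |a / b| * |B - b| := by
    refine (abs_add_le _ _).trans (add_le_add le_rfl ?_)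
    rw [abs_mul, abs_sub_comm b B]
  have h0 : 0 ≤ |A - a| + |a / b| * |B - b| := by positivity
  exact (div_le_div_of_nonneg_right hnum hB0.le).trans (div_le_div_of_nonneg_left h0 hβ hB)

/-- The event split: a ratio deviation `≥ s` forces a deviation `≥ βs/2` of the numerator or of the
rescaled denominator. -/
theorem ratio_deviation_split {A B a b β s : ℝ} (hβ : 0 < β) (hB : β ≤ B) (hb : b ≠ 0)
    (hs : s ≤ |A / B - a / b|) : β * s / 2 ≤ |A - a| ∨ β * s / 2 ≤ |a / b * B - a| := by
  have h := hs.trans (abs_div_sub_div_le (A := A) (a := a) hβ hB hb)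
  rw [le_div_iff₀ hβ] at h
  have hre : |a / b| * |B - b| = |a / b * B - a| := by
    rw [← abs_mul]
    congr 1
    field_simp
  rw [hre] at h
  by_contra hcon
  push Not at hcon
  obtain ⟨h1, h2⟩ := hcon
  linarith

end Algebra

/-! ### The tail bound along a Doeblin chain -/

section Chain

variable {Ω : Type*} [MeasurableSpace Ω]
variable {κ : Kernel Ω Ω} [IsMarkovKernel κ] {μ₀ : Measure Ω} [IsProbabilityMeasure μ₀]
  {π : Measure Ω} [IsProbabilityMeasure π]

/-- **GAUSSIAN TAIL OF THE RATIO ESTIMATOR, ANY START.**  See the module docstring; the two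
hypotheses `h1`, `h2` ask that `N β s / 2` exceed the burn-in offsets `4C₁/ε`, `4C₂/ε`. -/
theorem chain_ratio_tail_le_of_doeblin (hπ : Kernel.Invariant κ π) {ε : ℝ≥0∞}
    (hmin : ∀ x {B : Set Ω}, MeasurableSet B → ε * π B ≤ κ x B) (hε0 : 0 < ε)
    {f g : Ω → ℝ} (hf : Measurable f) {Cf : ℝ} (hCf : ∀ x, |f x| ≤ Cf)
    (hg : Measurable g) {Cg β : ℝ} (hCg : ∀ x, |g x| ≤ Cg) (hβ : 0 < β) (hβg : ∀ x, β ≤ g x)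
    {N : ℕ} (hN : N ≠ 0) {s : ℝ}
    (h1 : 4 * (Cf + |∫ z, f z ∂π|) / ε.toReal ≤ N * (β * s / 2))
    (h2 : 4 * (|(∫ z, f z ∂π) / (∫ z, g z ∂π)| * Cg + |∫ z, f z ∂π|) / ε.toReal ≤ N * (β * s / 2)) :
    (Kernel.trajMeasure (X := fun _ : ℕ => Ω) μ₀
          (fun m : ℕ => κ.comap (fun y : (i : ↥(Finset.Iic m)) → Ω => y ⟨m, Finset.mem_Iic.2 le_rfl⟩)
            (measurable_pi_apply _))).real
        {x | s ≤ |(∑ i ∈ Finset.range N, f (x i)) / N / ((∑ i ∈ Finset.range N, g (x i)) / N)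
            - (∫ z, f z ∂π) / (∫ z, g z ∂π)|}
      ≤ 2 * Real.exp (-(N * (β * s / 2) - 4 * (Cf + |∫ z, f z ∂π|) / ε.toReal) ^ 2
            / (8 * N * (Cf + |∫ z, f z ∂π|) ^ 2 / ε.toReal ^ 2))
        + 2 * Real.exp (-(N * (β * s / 2)
              - 4 * (|(∫ z, f z ∂π) / (∫ z, g z ∂π)| * Cg + |∫ z, f z ∂π|) / ε.toReal) ^ 2
            / (8 * N * (|(∫ z, f z ∂π) / (∫ z, g z ∂π)| * Cg + |∫ z, f z ∂π|) ^ 2 / ε.toReal ^ 2)) := by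
  set P := Kernel.trajMeasure (X := fun _ : ℕ => Ω) μ₀
      (fun m : ℕ => κ.comap (fun y : (i : ↥(Finset.Iic m)) → Ω => y ⟨m, Finset.mem_Iic.2 le_rfl⟩)
        (measurable_pi_apply _)) with hP
  set a := ∫ z, f z ∂π with ha
  set b := ∫ z, g z ∂π with hb
  have hbβ : β ≤ b := le_integral_of_le hg hCg hβg
  have hb0 : b ≠ 0 := (hβ.trans_le hbβ).ne'
  have hBβ : ∀ x : ℕ → Ω, β ≤ (∑ i ∈ Finset.range N, g (x i)) / N := le_timeAverage hβg hN
  -- the rescaled denominator observable `f' = (a/b) g`: bounded by `|a/b| C_g`, mean `a`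
  have hf'm : Measurable fun z => a / b * g z := hg.const_mul _
  have hf'b : ∀ z, |a / b * g z| ≤ |a / b| * Cg := fun z => by
    rw [abs_mul]; exact mul_le_mul_of_nonneg_left (hCg z) (abs_nonneg _)
  have hf'mean : ∫ z, a / b * g z ∂π = a := by
    rw [integral_const_mul, ← hb]; field_simp
  have hf'avg : ∀ x : ℕ → Ω, (∑ i ∈ Finset.range N, a / b * g (x i)) / N
      = a / b * ((∑ i ∈ Finset.range N, g (x i)) / N) := fun x => by
    rw [← Finset.mul_sum, mul_div_assoc]
  -- the two Hoeffding tails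
  have hT1 := chain_abs_tail_le_exp_of_doeblin (μ₀ := μ₀) hπ hmin hε0 hf hCf hN h1
  rw [← hP, ← ha] at hT1
  have h2' : 4 * (|a / b| * Cg + |∫ z, a / b * g z ∂π|) / ε.toReal ≤ N * (β * s / 2) := by
    rw [hf'mean]; exact h2
  have hT2 := chain_abs_tail_le_exp_of_doeblin (μ₀ := μ₀) hπ hmin hε0 hf'm hf'b hN h2'
  rw [← hP, hf'mean] at hT2
  simp_rw [hf'avg] at hT2
  -- the event split
  have hsub : {x : ℕ → Ω | s ≤ |(∑ i ∈ Finset.range N, f (x i)) / N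
        / ((∑ i ∈ Finset.range N, g (x i)) / N) - a / b|}
      ⊆ {x | β * s / 2 ≤ |(∑ i ∈ Finset.range N, f (x i)) / N - a|}
        ∪ {x | β * s / 2 ≤ |a / b * ((∑ i ∈ Finset.range N, g (x i)) / N) - a|} := fun x hx =>
    ratio_deviation_split hβ (hBβ x) hb0 hx
  calc P.real {x | s ≤ |(∑ i ∈ Finset.range N, f (x i)) / N
          / ((∑ i ∈ Finset.range N, g (x i)) / N) - a / b|}
      ≤ P.real ({x | β * s / 2 ≤ |(∑ i ∈ Finset.range N, f (x i)) / N - a|}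
          ∪ {x | β * s / 2 ≤ |a / b * ((∑ i ∈ Finset.range N, g (x i)) / N) - a|}) :=
        measureReal_mono hsub
    _ ≤ P.real {x | β * s / 2 ≤ |(∑ i ∈ Finset.range N, f (x i)) / N - a|}
          + P.real {x | β * s / 2 ≤ |a / b * ((∑ i ∈ Finset.range N, g (x i)) / N) - a|} :=
        measureReal_union_le _ _
    _ ≤ _ := add_le_add hT1 hT2

end Chain

/-! ### The instance for row 8's protocol class: reweighting along the restart chain -/

section Restart

variable {Ω E : Type*} [MeasurableSpace Ω] [MeasurableSpace E]
variable {κ₀ : Kernel Ω Ω} [IsMarkovKernel κ₀] {κF : Kernel Ω E} [IsMarkovKernel κF]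
  {π₀ : Measure Ω} [IsProbabilityMeasure π₀] {μ₀ : Measure (Ω × E)} [IsProbabilityMeasure μ₀]
  {ε : ℝ≥0∞}

/-- **GAUSSIAN TAIL OF THE CORRELATED-RESTART REWEIGHTING ESTIMATOR, ANY START.**  Prior chain
`κ₀` with invariant law `π₀`, `κ₀(x, ·) ≥ ε π₀` (`ε > 0`); restart chain `K(x, ω) = κ₀ x ⊗ₘ κF`,
`Π = π₀ ⊗ₘ κF`; `|G₁| ≤ C₁`, `β ≤ G₂ ≤ C₂` (`β > 0`); `a = Π G₁`, `b = Π G₂`.  With the offsets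
`4(C₁ + |a|)/ε` and `4(|a/b| C₂ + |a|)/ε` below `N β s/2`:
`P(|Σ G₁/Σ G₂ − a/b| ≥ s) ≤ 2 exp(⋯) + 2 exp(⋯)` exactly as in `chain_ratio_tail_le_of_doeblin`. -/
theorem restart_ratio_tail_le_of_doeblin (hπ₀ : Kernel.Invariant κ₀ π₀)
    (hmin : ∀ x {B : Set Ω}, MeasurableSet B → ε * π₀ B ≤ κ₀ x B) (hε0 : 0 < ε)
    {G₁ G₂ : Ω × E → ℝ} (hG₁ : Measurable G₁) {C₁ : ℝ} (hC₁ : ∀ p, |G₁ p| ≤ C₁)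
    (hG₂ : Measurable G₂) {C₂ β : ℝ} (hC₂ : ∀ p, |G₂ p| ≤ C₂) (hβ : 0 < β) (hβG : ∀ p, β ≤ G₂ p)
    {N : ℕ} (hN : N ≠ 0) {s : ℝ}
    (h1 : 4 * (C₁ + |∫ p, G₁ p ∂(π₀ ⊗ₘ κF)|) / ε.toReal ≤ N * (β * s / 2))
    (h2 : 4 * (|(∫ p, G₁ p ∂(π₀ ⊗ₘ κF)) / (∫ p, G₂ p ∂(π₀ ⊗ₘ κF))| * C₂ + |∫ p, G₁ p ∂(π₀ ⊗ₘ κF)|)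
      / ε.toReal ≤ N * (β * s / 2)) :
    (Kernel.trajMeasure (X := fun _ : ℕ => Ω × E) μ₀
          (fun m : ℕ => ((Kernel.prodMkRight E κ₀) ⊗ₖ (Kernel.prodMkLeft (Ω × E) κF)).comap
            (fun h : (i : ↥(Finset.Iic m)) → Ω × E => h ⟨m, Finset.mem_Iic.2 le_rfl⟩)
            (measurable_pi_apply _))).real
        {x | s ≤ |(∑ i ∈ Finset.range N, G₁ (x i)) / N / ((∑ i ∈ Finset.range N, G₂ (x i)) / N)
            - (∫ p, G₁ p ∂(π₀ ⊗ₘ κF)) / (∫ p, G₂ p ∂(π₀ ⊗ₘ κF))|}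
      ≤ 2 * Real.exp (-(N * (β * s / 2) - 4 * (C₁ + |∫ p, G₁ p ∂(π₀ ⊗ₘ κF)|) / ε.toReal) ^ 2
            / (8 * N * (C₁ + |∫ p, G₁ p ∂(π₀ ⊗ₘ κF)|) ^ 2 / ε.toReal ^ 2))
        + 2 * Real.exp (-(N * (β * s / 2)
              - 4 * (|(∫ p, G₁ p ∂(π₀ ⊗ₘ κF)) / (∫ p, G₂ p ∂(π₀ ⊗ₘ κF))| * C₂
                  + |∫ p, G₁ p ∂(π₀ ⊗ₘ κF)|) / ε.toReal) ^ 2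
            / (8 * N * (|(∫ p, G₁ p ∂(π₀ ⊗ₘ κF)) / (∫ p, G₂ p ∂(π₀ ⊗ₘ κF))| * C₂
                + |∫ p, G₁ p ∂(π₀ ⊗ₘ κF)|) ^ 2 / ε.toReal ^ 2)) :=
  chain_ratio_tail_le_of_doeblin (μ₀ := μ₀) (invariant_restart hπ₀)
    (fun p _ hS => restart_doeblin (κF := κF) hmin p hS) hε0 hG₁ hC₁ hG₂ hC₂ hβ hβG hN h1 h2

end Restart

end Summit.Ventures.LatticeQCDFlow.Scoring

end
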